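import Summits.CriticalPhenomena.CardyFormulaZ2.Theorems.CardyAnchoredRigiditySubseqCardyJointLimitSymmetry
import Summits.CriticalPhenomena.CardyFormulaZ2.Theorems.CardyAnchoredRigidityClusterSetConnected
import Summits.CriticalPhenomena.CardyFormulaZ2.Theorems.CardyWhiteToColouredSimilarityUpgradeStubRectangleDuality
import Literature.Probability.Percolation.QuadCrossingSquareModel

/-!
# Every joint sequential limit gives the square crossing probability `1/2`
# (crux `SubseqCardy`, stmt-CriticalPhenomena-5768, line `registered`: structure of joint limits, part 5)

Route `CardyAnchoredRigidity` (decl shared with `CardyLocalRigidity`), sub-problem `CardyFormulaZ2`.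
The first VALUE of the joint sequential limits `g` of the bond-`ℤ²` crossing probabilities (the
objects of S2/S3): for the unit box `(0,1)²` crossed from its bottom to its top side,
`g = 1/2` — for EVERY joint limit along EVERY mesh sequence (`JointLimit.btUnitBox_eq_half`,
registered sub-goal `jointLimit_btUnitBox_eq_half`). Part 6 turns this into Cardy's formula for
squares (`η = 1/2`, `F(1/2) = 1/2`), unconditionally.

Proof. (1) FITTED MESHES: along `1/m`, `m = ⌊1/u n⌋₊`, the crossing probabilities of any fixed
rectangle have the same limit as along `u n` (`JointLimit.tendsto_fitted`; the tree's
`scaleContinuity`, `1/m ∈ [u n, (1+θ) u n]`). (2) LATTICE BOUNDS at a fitted mesh `1/m` for the box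
`(0,w) × (0,1)` crossed bottom-to-top (`rectQuad 0 w 0 1`): its crossing probability is caught
between bottom–top crossings of lattice boxes `[0,a'] × [0,m-2]`, `a' ∈ {a-1, a}`,
`a + 1 < w m ≤ a + 2` (`le_bond_bt`, `bond_bt_le` of the tree's rectangle-duality file), i.e. between
`h(m-2, a-1)` and `h(m-2, a)` (`h` = `crossingProb half`, transposition `real_shift_tbCrossing`);
by the exact value `h(n+1, n) = 1/2` (`crossingProb_half_succ_self_holds`) and monotonicity in the
width (`crossingProb_anti_left`): `≥ 1/2` when `w ≥ 1` (`half_le_bond_bt`) and `≤ 1/2` when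
`w < 1`, `1/m ≤ 1 - w` (`bond_bt_le_half`). (3) So `g ((0,w)×(0,1)) ≥ 1/2` for `w = 1` and `≤ 1/2`
for every `w < 1`; (4) `w ↦ g ((0,w)×(0,1))` is continuous at `1` — the box of width `w` has the
carrier and arcs of the image of the unit box under the stretch `x + iy ↦ wx + iy`, which is
uniformly close to the identity near the box, and `g` is Schramm–Smirnov continuous
(`JointLimit.abs_sub_map_le`). No arm estimate beyond what these inputs contain is used.

References: B. Bollobás, O. Riordan, *Percolation* (2006), Ch. 3 Lemma 1, Cor. 3; O. Schramm,
S. Smirnov, Ann. Probab. 39 (2011) §5.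
-/

noncomputable section

namespace Summit.CriticalPhenomena.CardyFormulaZ2.Cruxes.SubseqCardy.Birth

open Set Filter Topology Metric MeasureTheory Complex
open Literature.Probability.RandomPlanarGeometry (ConformalRectangle MarkedDomain)
open Literature.Probability.LatticeModels
open Literature.Probability.Percolation (bondDomainCrossingProb crossingProb half rectQuad rectQuad_carrier
  mem_rectQuad_arc_zero mem_rectQuad_arc_two crossingProb_anti_left crossingProb_half_succ_self_holds)
open Summit.CriticalPhenomena.CardyFormulaZ2.Theorems.ClusterSetConnected (scaleContinuity)
open Summit.CriticalPhenomena.CardyFormulaZ2.Cruxes.SimilarityUpgrade.Stubs.RectangleDuality (bond_bt_le le_bond_bt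
  real_shift_tbCrossing)

namespace JointLimit

variable {u : ℕ → ℝ} {g : ConformalRectangle → ℝ}

/-! ### Crossing probabilities only see the carrier and the two arcs -/

/-- `bondDomainCrossingProb R` depends only on the carrier and on the arcs `0`, `2` of `R`.
[folklore] -/
theorem bondDomainCrossingProb_congr {R R' : ConformalRectangle} (hc : R.carrier = R'.carrier)
    (h0 : R.arc 0 = R'.arc 0) (h2 : R.arc 2 = R'.arc 2) :
    bondDomainCrossingProb R = bondDomainCrossingProb R' := by
  funext δ
  simp only [bondDomainCrossingProb, hc, h0, h2]

/-- Joint limits agree on rectangles with the same carrier and the same arcs `0`, `2`. [folklore] -/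
theorem congr (hg : ∀ R : ConformalRectangle, Tendsto (fun n => bondDomainCrossingProb R (u n)) atTop (𝓝 (g R)))
    {R R' : ConformalRectangle} (hc : R.carrier = R'.carrier) (h0 : R.arc 0 = R'.arc 0)
    (h2 : R.arc 2 = R'.arc 2) : g R = g R' := by
  refine tendsto_nhds_unique (hg R) ?_
  rw [bondDomainCrossingProb_congr hc h0 h2]
  exact hg R'

/-! ### The boxes `(0,w) × (0,1)` crossed from bottom to top -/

/-- The carrier of the box. [folklore] -/
theorem btBox_carrier {w : ℝ} (hw : 0 < w) : (rectQuad 0 w 0 1 hw one_pos).carrier = (Ioo (0:ℝ) w ×ℂ Ioo (0:ℝ) 1) :=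
  rectQuad_carrier _ _

/-- Arc `0` of the box is its bottom side. [folklore] -/
theorem btBox_arc_zero {w : ℝ} (hw : 0 < w) : (rectQuad 0 w 0 1 hw one_pos).arc 0 = {z : ℂ | z.im = 0 ∧ z.re ∈ Icc (0:ℝ) w} := by
  ext z; exact mem_rectQuad_arc_zero hw one_pos

/-- Arc `2` of the box is its top side. [folklore] -/
theorem btBox_arc_two {w : ℝ} (hw : 0 < w) : (rectQuad 0 w 0 1 hw one_pos).arc 2 = {z : ℂ | z.im = 1 ∧ z.re ∈ Icc (0:ℝ) w} := by
  ext z; exact mem_rectQuad_arc_two hw one_pos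

/-- Windows: every real `x > 1` lies in some `(a + 1, a + 2]`, `a : ℕ`. [folklore] -/
theorem exists_window {x : ℝ} (hx : 1 < x) : ∃ a : ℕ, (a : ℝ) + 1 < x ∧ x ≤ a + 2 := by
  have h2 : 2 ≤ ⌈x⌉₊ := Nat.lt_ceil.2 (by exact_mod_cast hx)
  refine ⟨⌈x⌉₊ - 2, ?_, ?_⟩
  · have h := Nat.ceil_lt_add_one (by linarith : (0 : ℝ) ≤ x)
    rw [Nat.cast_sub h2]; push_cast; linarith
  · have h := Nat.le_ceil x
    rw [Nat.cast_sub h2]; push_cast; linarith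

/-- **At a fitted mesh `1/m`, a box at least as wide as tall is crossed bottom-to-top with probability
at least `1/2`.** Its crossing event contains the bottom–top crossing of the lattice box
`[0, a-1] × [0, m-2]` with `a ≥ m - 2` (`le_bond_bt`), of probability `h(m-2, a-1) ≥ h(a, a-1) = 1/2`.
[cite: BollobasRiordan2006, Ch. 3 Lemma 1 and Cor. 3] -/
theorem half_le_bond_bt {w : ℝ} (hw : 1 ≤ w) {m : ℕ} (hm : 3 ≤ m) :
    1 / 2 ≤ bondDomainCrossingProb (rectQuad 0 w 0 1 (by linarith) one_pos) (1 / m) := by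
  have hm0 : (0:ℝ) < m := by exact_mod_cast (by omega : 0 < m)
  have hδ : (0:ℝ) < 1 / m := by positivity
  -- the window of the width and the fitting of the height
  have hx : 1 < w * m := by
    have : (3:ℝ) ≤ m := by exact_mod_cast hm
    nlinarith
  obtain ⟨a, ha1, ha2⟩ := exists_window hx
  have ha : 1 / (m:ℝ) * (a + 1) < w := by
    rw [div_mul_eq_mul_div, one_mul, div_lt_iff₀ hm0]; exact ha1
  have ha' : w ≤ 1 / (m:ℝ) * (a + 2) := by
    rw [div_mul_eq_mul_div, one_mul, le_div_iff₀ hm0]; exact ha2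
  have hb : 1 / (m:ℝ) * (((m - 2 : ℕ) : ℝ) + 2) = 1 := by
    rw [Nat.cast_sub (by omega : 2 ≤ m)]; push_cast; field_simp; ring
  -- `a ≥ m - 2 ≥ 1`
  have ham : m ≤ a + 2 := by
    have h1 : (m:ℝ) ≤ w * m := le_mul_of_one_le_left hm0.le hw
    have h2 : (m:ℝ) ≤ a + 2 := h1.trans ha2
    exact_mod_cast h2
  have ha1' : 1 ≤ a := by omega
  have hlow := le_bond_bt (rectQuad 0 w 0 1 (by linarith) one_pos) (btBox_carrier _) (btBox_arc_zero _) (btBox_arc_two _) hδ ha ha'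
    hb (a' := a - 1) (by omega)
  rw [real_shift_tbCrossing] at hlow
  refine le_trans ?_ hlow
  -- `h(m-2, a-1) ≥ h(a, a-1) = 1/2`
  have hself := crossingProb_half_succ_self_holds (a - 1)
  rw [Nat.sub_add_cancel ha1'] at hself
  rw [← hself]
  exact crossingProb_anti_left half (by omega) (a - 1)

/-- **At a fitted mesh `1/m ≤ 1 - w`, a box narrower than tall is crossed bottom-to-top with
probability at most `1/2`.** Its crossing event is contained in the bottom–top crossing of the lattice
box `[0, a] × [0, m-2]` with `a + 1 ≤ m - 2` (`bond_bt_le`), of probability `h(m-2, a) ≤ h(a+1, a) = 1/2`.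
[cite: BollobasRiordan2006, Ch. 3 Lemma 1 and Cor. 3] -/
theorem bond_bt_le_half {w : ℝ} (hw0 : 0 < w) {m : ℕ} (hm : 0 < m) (hwm : 1 < w * m)
    (hδw : 1 / (m:ℝ) ≤ 1 - w) :
    bondDomainCrossingProb (rectQuad 0 w 0 1 hw0 one_pos) (1 / m) ≤ 1 / 2 := by
  have hm0 : (0:ℝ) < m := by exact_mod_cast hm
  have hδ : (0:ℝ) < 1 / m := by positivity
  obtain ⟨a, ha1, ha2⟩ := exists_window hwm
  have ha : 1 / (m:ℝ) * (a + 1) < w := by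
    rw [div_mul_eq_mul_div, one_mul, div_lt_iff₀ hm0]; exact ha1
  have ha' : w ≤ 1 / (m:ℝ) * (a + 2) := by
    rw [div_mul_eq_mul_div, one_mul, le_div_iff₀ hm0]; exact ha2
  -- `w ≤ 1 - 1/m` forces `a + 1 ≤ m - 2`
  have hm2 : 2 ≤ m := by
    by_contra h
    have h1 : m = 1 := by omega
    subst h1
    simp only [Nat.cast_one, div_one] at hδw
    linarith
  have hb : 1 / (m:ℝ) * (((m - 2 : ℕ) : ℝ) + 2) = 1 := by
    rw [Nat.cast_sub hm2]; push_cast; field_simp; ring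
  have ham : a + 3 ≤ m := by
    have h1 : (a:ℝ) + 1 < w * m := ha1
    have h2 : w * m ≤ (1 - 1 / (m:ℝ)) * m := by nlinarith
    have h3 : (1 - 1 / (m:ℝ)) * m = m - 1 := by field_simp
    have h4 : (a:ℝ) + 1 < m - 1 := by linarith
    have h5 : (a:ℝ) + 2 < m := by linarith
    have h6 : a + 2 < m := by exact_mod_cast h5
    omega
  have hup := bond_bt_le (rectQuad 0 w 0 1 hw0 one_pos) (btBox_carrier _) (btBox_arc_zero _) (btBox_arc_two _) hδ ha ha' hb
  rw [real_shift_tbCrossing] at hup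
  refine hup.trans ?_
  rw [← crossingProb_half_succ_self_holds a]
  exact crossingProb_anti_left half (by omega) a

/-! ### Fitted meshes carry the joint limit -/

/-- **Along the fitted meshes `1/⌊1/u n⌋₊` every coordinate has the same limit as along `u`** (scale
continuity of each crossing probability, the tree's `scaleContinuity`: `1/⌊1/u n⌋₊` lies in
`[u n, (1 + θ) u n]` eventually). [folklore] -/
theorem tendsto_fitted (hu : Tendsto u atTop (𝓝[>] (0 : ℝ)))
    (hg : ∀ R : ConformalRectangle, Tendsto (fun n => bondDomainCrossingProb R (u n)) atTop (𝓝 (g R)))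
    (R : ConformalRectangle) :
    Tendsto (fun n => bondDomainCrossingProb R (1 / (⌊1 / u n⌋₊ : ℝ))) atTop (𝓝 (g R)) := by
  have hu0 : Tendsto u atTop (𝓝 (0:ℝ)) := (tendsto_nhdsWithin_iff.1 hu).1
  have hupos : ∀ᶠ n in atTop, 0 < u n := (tendsto_nhdsWithin_iff.1 hu).2
  -- the difference to the sequence along `u` tends to `0`
  have hdiff : Tendsto (fun n => bondDomainCrossingProb R (1 / (⌊1 / u n⌋₊ : ℝ)) - bondDomainCrossingProb R (u n))
      atTop (𝓝 0) := by
    rw [Metric.tendsto_nhds]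
    intro ε hε
    obtain ⟨θ, hθ, δ₀, hδ₀, H⟩ := scaleContinuity R ε hε
    have hsmall : ∀ᶠ n in atTop, u n < min (θ / (1 + θ)) (δ₀ / (1 + θ)) :=
      hu0.eventually (Iio_mem_nhds (lt_min (by positivity) (by positivity)))
    filter_upwards [hupos, hsmall] with n hn hns
    have hnθ : u n < θ / (1 + θ) := hns.trans_le (min_le_left _ _)
    have hnδ : u n < δ₀ / (1 + θ) := hns.trans_le (min_le_right _ _)
    have hθ1 : θ / (1 + θ) < 1 := (div_lt_one (by positivity)).2 (by linarith)
    have hu1 : u n < 1 := hnθ.trans hθ1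
    -- `m = ⌊1/u n⌋₊ ≥ 1` and `1/m ∈ [u n, (1+θ) u n]`
    have hinv : 1 < 1 / u n := (one_lt_div hn).2 hu1
    have hm1 : 1 ≤ ⌊1 / u n⌋₊ := Nat.le_floor (by exact_mod_cast hinv.le)
    have hm0 : (0:ℝ) < ⌊1 / u n⌋₊ := by exact_mod_cast hm1
    have hmle : (⌊1 / u n⌋₊ : ℝ) ≤ 1 / u n := Nat.floor_le (by positivity)
    have hmge : 1 / u n - 1 < ⌊1 / u n⌋₊ := by
      have := Nat.lt_floor_add_one (1 / u n); linarith
    have h1 : u n ≤ 1 / (⌊1 / u n⌋₊ : ℝ) := by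
      rw [le_div_iff₀ hm0]
      calc u n * ⌊1 / u n⌋₊ ≤ u n * (1 / u n) := by gcongr
        _ = 1 := mul_one_div_cancel hn.ne'
    have h2 : 1 / (⌊1 / u n⌋₊ : ℝ) ≤ (1 + θ) * u n := by
      rw [div_le_iff₀ hm0]
      -- `1 ≤ (1+θ) u ((1/u) - 1) = (1+θ)(1 - u)`, true since `u ≤ θ/(1+θ)`
      have key : 1 ≤ (1 + θ) * u n * (1 / u n - 1) := by
        have e : (1 + θ) * u n * (1 / u n - 1) = (1 + θ) * (1 - u n) := by
          field_simp
        rw [e]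
        have h' : u n * (1 + θ) < θ := (lt_div_iff₀ (by positivity)).1 hnθ
        nlinarith
      have hpos : 0 ≤ (1 + θ) * u n := by positivity
      nlinarith
    have h3 : 1 / (⌊1 / u n⌋₊ : ℝ) < δ₀ := by
      have : (1 + θ) * u n < δ₀ := by
        rw [lt_div_iff₀ (by positivity)] at hnδ; linarith
      linarith
    have := H (u n) (1 / (⌊1 / u n⌋₊ : ℝ)) hn h1 h3 h2
    rwa [Real.dist_eq, sub_zero]
  have := hdiff.add (hg R)
  simp only [zero_add, sub_add_cancel] at this
  exact this

/-! ### The unit box is crossed with limiting probability `1/2` along every joint limit -/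

/-- **Every joint sequential limit gives the bottom-to-top crossing of the unit box probability
`1/2`.** [folklore] -/
theorem btUnitBox_eq_half (hu : Tendsto u atTop (𝓝[>] (0 : ℝ)))
    (hg : ∀ R : ConformalRectangle, Tendsto (fun n => bondDomainCrossingProb R (u n)) atTop (𝓝 (g R))) :
    g (rectQuad 0 1 0 1 one_pos one_pos) = 1 / 2 := by
  have hu0 : Tendsto u atTop (𝓝 (0:ℝ)) := (tendsto_nhdsWithin_iff.1 hu).1
  have hupos : ∀ᶠ n in atTop, 0 < u n := (tendsto_nhdsWithin_iff.1 hu).2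
  -- the fitted meshes `1/m n`, `m n = ⌊1/u n⌋₊ → ∞`
  have hm : Tendsto (fun n => ⌊1 / u n⌋₊) atTop atTop := by
    refine tendsto_atTop.2 fun M => ?_
    have hsmall : ∀ᶠ n in atTop, u n < 1 / ((M:ℝ) + 1) := hu0.eventually (Iio_mem_nhds (by positivity))
    filter_upwards [hupos, hsmall] with n hn hns
    refine Nat.le_floor ?_
    have : (M:ℝ) + 1 ≤ 1 / u n := by
      rw [le_div_iff₀ hn]
      have := (lt_div_iff₀ (by positivity : (0:ℝ) < M + 1)).1 hns
      linarith
    linarith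
  -- (≥) : the unit box itself at fitted meshes
  have hge : 1 / 2 ≤ g (rectQuad 0 1 0 1 one_pos one_pos) := by
    refine ge_of_tendsto (tendsto_fitted hu hg (rectQuad 0 1 0 1 one_pos one_pos)) ?_
    filter_upwards [hm.eventually_ge_atTop 3] with n hn
    exact half_le_bond_bt le_rfl hn
  -- (≤) : slightly narrower boxes at fitted meshes, then continuity at width `1`
  have hle_w : ∀ w : ℝ, ∀ hw : 0 < w, w < 1 → g (rectQuad 0 w 0 1 hw one_pos) ≤ 1 / 2 := by
    intro w hw hw1
    refine le_of_tendsto (tendsto_fitted hu hg (rectQuad 0 w 0 1 hw one_pos)) ?_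
    have h1 : ∀ᶠ n in atTop, 1 / (⌊1 / u n⌋₊ : ℝ) ≤ 1 - w := by
      obtain ⟨M, hM⟩ := exists_nat_one_div_lt (by linarith : 0 < 1 - w)
      filter_upwards [hm.eventually_ge_atTop (M + 1)] with n hn
      have hn' : (M:ℝ) + 1 ≤ ⌊1 / u n⌋₊ := by exact_mod_cast hn
      exact (one_div_le_one_div_of_le (by positivity) hn').trans hM.le
    have h2 : ∀ᶠ n in atTop, 1 < w * ⌊1 / u n⌋₊ := by
      obtain ⟨M, hM⟩ := exists_nat_gt (1 / w)
      filter_upwards [hm.eventually_ge_atTop M] with n hn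
      have hn' : (M:ℝ) ≤ ⌊1 / u n⌋₊ := by exact_mod_cast hn
      have : 1 / w < ⌊1 / u n⌋₊ := hM.trans_le hn'
      rw [div_lt_iff₀ hw] at this
      linarith
    filter_upwards [h1, h2, hm.eventually_ge_atTop 1] with n hn1 hn2 hn3
    exact bond_bt_le_half hw (by omega) hn2 hn1
  refine le_antisymm ?_ hge
  -- continuity of `w ↦ g ((0,w)×(0,1))` at `1` through the stretch `x + iy ↦ wx + iy`
  refine le_of_forall_pos_le_add fun ε hε => ?_
  obtain ⟨η, hη, hcont⟩ := abs_sub_map_le hu hg (rectQuad 0 1 0 1 one_pos one_pos) hε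
  set w : ℝ := 1 - min (1 / 4) (η / 4) with hwdef
  have hmin : 0 < min (1 / 4) (η / 4) := lt_min (by norm_num) (by positivity)
  have hw1 : w < 1 := by rw [hwdef]; linarith
  have hw0 : 0 < w := by
    rw [hwdef]; linarith [min_le_left (1 / 4 : ℝ) (η / 4)]
  have hwη : 2 * (1 - w) ≤ η := by
    rw [hwdef]; linarith [min_le_right (1 / 4 : ℝ) (η / 4)]
  obtain ⟨A, hA⟩ := CountableApprox.exists_stretch w 1 hw0.ne' one_ne_zero
  -- the stretched unit box has the carrier and arcs of the box of width `w`
  have hAimg : ∀ (S T : Set ℝ), A '' (S ×ℂ T) = ((fun x => w * x) '' S) ×ℂ T := by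
    intro S T
    ext z
    simp only [mem_image, Complex.mem_reProdIm]
    constructor
    · rintro ⟨p, ⟨hp1, hp2⟩, rfl⟩
      exact ⟨⟨p.re, hp1, (hA p).1.symm⟩, by rw [(hA p).2, one_mul]; exact hp2⟩
    · rintro ⟨⟨x, hx, hxz⟩, hz2⟩
      refine ⟨⟨x, z.im⟩, ⟨hx, hz2⟩, ?_⟩
      apply Complex.ext
      · rw [(hA _).1]; exact hxz
      · rw [(hA _).2, one_mul]
  have hc : ((rectQuad 0 1 0 1 one_pos one_pos).map A).carrier = (rectQuad 0 w 0 1 hw0 one_pos).carrier := by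
    rw [MarkedDomain.carrier_map, btBox_carrier, btBox_carrier, hAimg, image_mul_left_Ioo hw0 0 1]
    simp
  have harc : ∀ (t : ℝ), A '' {z : ℂ | z.im = t ∧ z.re ∈ Icc (0:ℝ) 1} = {z : ℂ | z.im = t ∧ z.re ∈ Icc (0:ℝ) w} := by
    intro t
    have e1 : {z : ℂ | z.im = t ∧ z.re ∈ Icc (0:ℝ) 1} = (Icc (0:ℝ) 1 ×ℂ {t}) := by
      ext z; simp [Complex.mem_reProdIm, and_comm]
    have e2 : {z : ℂ | z.im = t ∧ z.re ∈ Icc (0:ℝ) w} = (Icc (0:ℝ) w ×ℂ {t}) := by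
      ext z; simp [Complex.mem_reProdIm, and_comm]
    rw [e1, e2, hAimg, image_mul_left_Icc hw0.le zero_le_one]
    simp
  have h0 : ((rectQuad 0 1 0 1 one_pos one_pos).map A).arc 0 = (rectQuad 0 w 0 1 hw0 one_pos).arc 0 := by
    rw [MarkedDomain.arc_map, btBox_arc_zero, btBox_arc_zero, harc]
  have h2 : ((rectQuad 0 1 0 1 one_pos one_pos).map A).arc 2 = (rectQuad 0 w 0 1 hw0 one_pos).arc 2 := by
    rw [MarkedDomain.arc_map, btBox_arc_two, btBox_arc_two, harc]
  -- the stretch moves the unit neighbourhood of the box by at most `2 (1 - w) ≤ η`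
  have hclose : ∀ z ∈ Metric.cthickening 1 (closure (rectQuad 0 1 0 1 one_pos one_pos).carrier), dist (A z) z ≤ η := by
    intro z hz
    have hzre : |z.re| ≤ 2 := by
      have hK : IsCompact (closure (rectQuad 0 1 0 1 one_pos one_pos).carrier) := by
        rw [btBox_carrier, Complex.closure_reProdIm, closure_Ioo (zero_ne_one' ℝ)]
        exact isCompact_Icc.reProdIm isCompact_Icc
      rw [hK.cthickening_eq_biUnion_closedBall zero_le_one, mem_iUnion₂] at hz
      obtain ⟨y, hy, hzy⟩ := hz
      rw [btBox_carrier, Complex.closure_reProdIm, closure_Ioo (zero_ne_one' ℝ),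
        Complex.mem_reProdIm, mem_Icc] at hy
      have hd : dist z y ≤ 1 := mem_closedBall.1 hzy
      have hre : |z.re - y.re| ≤ dist z y := by
        rw [dist_eq_norm]; exact Complex.abs_re_le_norm (z - y)
      have htri : |z.re| ≤ |z.re - y.re| + |y.re| := by
        calc |z.re| = |(z.re - y.re) + y.re| := by ring_nf
          _ ≤ |z.re - y.re| + |y.re| := abs_add_le _ _
      have hy1 : |y.re| ≤ 1 := abs_le.2 ⟨by linarith [hy.1.1], hy.1.2⟩
      linarith
    rw [dist_eq_norm]
    refine (Complex.norm_le_abs_re_add_abs_im _).trans ?_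
    rw [Complex.sub_re, Complex.sub_im, (hA z).1, (hA z).2, one_mul, sub_self, abs_zero, add_zero,
      show w * z.re - z.re = -((1 - w) * z.re) by ring, abs_neg, abs_mul, abs_of_pos (by linarith : 0 < 1 - w)]
    nlinarith
  have key := hcont A hclose
  rw [congr hg hc h0 h2] at key
  have hwle := hle_w w hw0 hw1
  rw [abs_le] at key
  linarith [key.1, key.2]

end JointLimit

/-- **Registered sub-goal `jointLimit_btUnitBox_eq_half` (line `registered`, lead c3) — every joint
sequential limit of the bond-`ℤ²` crossing probabilities gives the unit box `(0,1)²`, crossed from its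
bottom to its top side, the value `1/2`** (`JointLimit.btUnitBox_eq_half`; the box is
`rectQuad 0 1 0 1`). [folklore] -/
theorem jointLimit_btUnitBox_eq_half : ∀ u : ℕ → ℝ, Filter.Tendsto u Filter.atTop (nhdsWithin (0 : ℝ) (Set.Ioi 0)) → ∀ g : Literature.Probability.RandomPlanarGeometry.ConformalRectangle → ℝ, (∀ R : Literature.Probability.RandomPlanarGeometry.ConformalRectangle, Filter.Tendsto (fun n => Literature.Probability.Percolation.bondDomainCrossingProb R (u n)) Filter.atTop (nhds (g R))) → g (Literature.Probability.Percolation.rectQuad 0 1 0 1 one_pos one_pos) = 1 / 2 :=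
  fun _ hu _ hg => JointLimit.btUnitBox_eq_half hu hg

end Summit.CriticalPhenomena.CardyFormulaZ2.Cruxes.SubseqCardy.Birth

end
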